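import Literature.Computability.QuantumComplexity.ZXCalculusEulerScalars
import HarnessLib

/-!
# `ZX_{π/4}` modulo the calculus: JPV's Lemma C1 (commutation of controls with a Hadamard edge)

Topic `Literature/Computability/QuantumComplexity`, continuing `ZXCalculusEulerScalars.lean`
(layer T2 of the formalisation of `JeandelPerdrixVilmart2018_completeness`).

* the two Euler forms of the `π/2` rotations as exact multiples of `H`:
  `Z(π/2) ⨾ X(π/2) ⨾ Z(π/2) = (√2 e^{iπ/4}/√2) ⊗ H` and `Z(-π/2) ⨾ X(-π/2) ⨾ Z(-π/2) =
  (√2 e^{-iπ/4}/√2) ⊗ H` (`euler_pos`, `euler_neg`);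
* **LMCS Lemma 17 = (C1)** (`c1Gadget_eq_mirror`): the `2 → 1` gadget `G(α, β)` — a Hadamard on
  the first input, green nodes `α` and `β` on the two wires joined by a Hadamard edge, then a red
  `π` carrying a green `α` leaf on the first wire and a red node carrying a green `β` leaf on the
  second, merged by a green node — equals its mirror image. Printed proof: Euler-decompose both
  Hadamards (Lemma 16, Lemma 6, (IV)), let the red `π/2` rotations absorb a pair of red states
  created by (B1), recognise the left-hand side of rule (C) at `γ = π/2`, apply (C), and fold back.
  Here: `G(α,β) = √2 ⊗ F(cLhs α β 2)` (`c1Gadget_eq`), `F(cLhs) = F(cRhs)` by (C), and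
  `√2 ⊗ F(cRhs α β 2)` is the mirror image (`c1GadgetMirror_eq`).

## References

* E. Jeandel, S. Perdrix, R. Vilmart, LMCS 16(2):11 (2020) (arXiv:1903.06035), App. A, Lemma 17
  (`lem:C1-original`) and its proof figure `control-commutation-2-proof`; LICS 2018
  (arXiv:1705.11151v2), Fig. 1 rule (C) [JeandelPerdrixVilmart2018].
-/

noncomputable section

namespace Literature.Computability.QuantumComplexity

open ZXDiagram ZXClass

namespace ZXClass

/-! ### Euler forms of the `π/2` rotations as multiples of `H` -/

/-- `Z(π/2) ⨾ X(π/2) ⨾ Z(π/2) = (1/√2) ⊗ (X^{(0,1)}(π) ⨾ Z^{(1,0)}(π/4)) ⊗ H`. [cite: JeandelPerdrixVilmart2018, Appendix Lemma 16] -/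
theorem euler_pos : mk (Z 1 1 2) ⨟ mk (X 1 1 2) ⨟ mk (Z 1 1 2) = mk invSqrtTwo ⊠ (mk (dumbbell 4 1) ⊠ mk hBox) := by
  have h1 : mk (dumbbell 0 0) ⊠ mk hBox = mk (dumbbell 4 (-1)) ⊠ (mk (Z 1 1 2) ⨟ mk (X 1 1 2) ⨟ mk (Z 1 1 2)) := by
    rw [hBox_eq_euler_scalars, scalar_par_scalar_par,
      show ∀ A : ZXClass 1 1, mk (dumbbell 0 0) ⊠ (mk invSqrtTwo ⊠ A) = (mk (dumbbell 0 0) ⊠ mk invSqrtTwo) ⊠ A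
        from fun A => (par_assoc' _ _ _).trans (cast_id _ _ _), inverse_rule, empty_par, cast_id]
  have h2 : mk (dumbbell 4 1) ⊠ (mk (dumbbell 0 0) ⊠ mk hBox) =
      mk (dumbbell 0 0) ⊠ (mk (dumbbell 0 0) ⊠ (mk (Z 1 1 2) ⨟ mk (X 1 1 2) ⨟ mk (Z 1 1 2))) := by
    rw [h1, show ∀ A : ZXClass 1 1, mk (dumbbell 4 1) ⊠ (mk (dumbbell 4 (-1)) ⊠ A) = (mk (dumbbell 4 1) ⊠ mk (dumbbell 4 (-1))) ⊠ A
        from fun A => (par_assoc' _ _ _).trans (cast_id _ _ _), dumbbell_four_mul, add_neg_cancel, dumbbell_four_zero]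
    exact (par_assoc _ _ _).trans (cast_id _ _ _)
  rw [scalar_par_scalar_par] at h2
  have h3 := cancel_sqrt_two_left h2
  -- h3 : db 4 1 ⊠ H = √2 ⊠ E; attach `1/√2`
  have h4 : mk invSqrtTwo ⊠ (mk (dumbbell 4 1) ⊠ mk hBox) = mk invSqrtTwo ⊠ (mk (dumbbell 0 0) ⊠ (mk (Z 1 1 2) ⨟ mk (X 1 1 2) ⨟ mk (Z 1 1 2))) := by
    rw [h3]
  rw [show ∀ A : ZXClass 1 1, mk invSqrtTwo ⊠ (mk (dumbbell 0 0) ⊠ A) = (mk invSqrtTwo ⊠ mk (dumbbell 0 0)) ⊠ A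
      from fun A => (par_assoc' _ _ _).trans (cast_id _ _ _), invSqrtTwo_par_dumbbell, empty_par, cast_id] at h4
  exact h4.symm

/-- The two Euler forms are mutually inverse: `(Z(π/2) X(π/2) Z(π/2)) ⨾ (Z(-π/2) X(-π/2) Z(-π/2)) = 𝕀`. [folklore] -/
theorem euler_pos_seq_euler_neg :
    (mk (Z 1 1 2) ⨟ mk (X 1 1 2) ⨟ mk (Z 1 1 2)) ⨟ (mk (Z 1 1 (-2)) ⨟ mk (X 1 1 (-2)) ⨟ mk (Z 1 1 (-2))) = mk (wires 1) := by
  simp only [seq_assoc]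
  rw [← seq_assoc (mk (Z 1 1 2)) (mk (Z 1 1 (-2))), phase_seq_phase, add_neg_cancel, Z_one_one, id_seq,
    ← seq_assoc (mk (X 1 1 2)) (mk (X 1 1 (-2))), xphase_seq_xphase, add_neg_cancel, X_one_one, id_seq,
    phase_seq_phase, add_neg_cancel, Z_one_one]

/-- `(1/√2 ⊗ db 4 (-1)) ⊗ (1/√2 ⊗ db 4 1) = 1` (`e^{-iπ/4} e^{iπ/4} = 1`). [cite: JeandelPerdrixVilmart2018, Appendix Lemmas 5, 6] -/
theorem euler_scalars_cancel :
    (mk invSqrtTwo ⊠ mk (dumbbell 4 (-1))) ⊠ (mk invSqrtTwo ⊠ mk (dumbbell 4 1)) = mk (wires 0) := by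
  rw [par_assoc, cast_id, scalar_par_scalar_par (mk (dumbbell 4 (-1))) (mk invSqrtTwo),
    show ∀ s : ZXClass 0 0, mk invSqrtTwo ⊠ (mk invSqrtTwo ⊠ s) = (mk invSqrtTwo ⊠ mk invSqrtTwo) ⊠ s
      from fun s => (par_assoc' _ _ _).trans (cast_id _ _ _), dumbbell_four_mul, neg_add_cancel, dumbbell_four_zero,
    par_assoc, cast_id, show ∀ s : ZXClass 0 0, mk invSqrtTwo ⊠ (mk (dumbbell 0 0) ⊠ s) = (mk invSqrtTwo ⊠ mk (dumbbell 0 0)) ⊠ s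
      from fun s => (par_assoc' _ _ _).trans (cast_id _ _ _), invSqrtTwo_par_dumbbell, empty_par, cast_id,
    invSqrtTwo_par_dumbbell]

/-- `Z(-π/2) ⨾ X(-π/2) ⨾ Z(-π/2) = (1/√2) ⊗ (X^{(0,1)}(π) ⨾ Z^{(1,0)}(-π/4)) ⊗ H` (the inverse Euler form,
from `H ∘ H = 𝕀`). [cite: JeandelPerdrixVilmart2018, Appendix Lemmas 8, 13, 16] -/
theorem euler_neg : mk (Z 1 1 (-2)) ⨟ mk (X 1 1 (-2)) ⨟ mk (Z 1 1 (-2)) = mk invSqrtTwo ⊠ (mk (dumbbell 4 (-1)) ⊠ mk hBox) := by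
  -- `H ⨾ E⁻ = c₊⁻¹ ⊗ 𝕀`, i.e. `c₊ ⊗ (H ⨾ E⁻) = 𝕀`… via `E ⨾ E⁻ = 𝕀` and `E = c₊ ⊗ H`
  have h1 : (mk invSqrtTwo ⊠ mk (dumbbell 4 1)) ⊠ (mk hBox ⨟ (mk (Z 1 1 (-2)) ⨟ mk (X 1 1 (-2)) ⨟ mk (Z 1 1 (-2)))) = mk (wires 1) := by
    rw [scalar_par_seq_left, empty_par, cast_id, par_assoc, cast_id, ← euler_pos, euler_pos_seq_euler_neg]
  -- prepend `H`: `c₊ ⊗ E⁻ = H`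
  have h2 : mk hBox ⨟ ((mk invSqrtTwo ⊠ mk (dumbbell 4 1)) ⊠ (mk hBox ⨟ (mk (Z 1 1 (-2)) ⨟ mk (X 1 1 (-2)) ⨟ mk (Z 1 1 (-2))))) = mk hBox := by
    rw [h1, seq_id]
  rw [seq_scalar_par_one, ← seq_assoc, hBox_seq_hBox, id_seq] at h2
  -- attach `c₋` and cancel
  have h3 : (mk invSqrtTwo ⊠ mk (dumbbell 4 (-1))) ⊠ ((mk invSqrtTwo ⊠ mk (dumbbell 4 1)) ⊠ (mk (Z 1 1 (-2)) ⨟ mk (X 1 1 (-2)) ⨟ mk (Z 1 1 (-2)))) =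
      (mk invSqrtTwo ⊠ mk (dumbbell 4 (-1))) ⊠ mk hBox := by rw [h2]
  rw [show ∀ (s t : ZXClass 0 0) (A : ZXClass 1 1), s ⊠ (t ⊠ A) = (s ⊠ t) ⊠ A from fun s t A => (par_assoc' _ _ _).trans (cast_id _ _ _),
    euler_scalars_cancel, empty_par, cast_id, par_assoc, cast_id] at h3
  exact h3

/-! ### Pieces of the (C1) gadget -/

/-- A red `π` below the final merge of two red nodes with green leaves lifts onto both red nodes:
`(xLeafL p α ⊗ xLeafR q β) ⨾ Z^{(2,1)} ⨾ X(π) = (xLeafL (p+π) α ⊗ xLeafR (q+π) β) ⨾ Z^{(2,1)}`.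
[cite: JeandelPerdrixVilmart2018, Appendix Lemma 4] -/
theorem xLeaves_merge_seq_X_pi (p q a b : ZMod 8) :
    (mk (xLeafL p a) ⊠ mk (xLeafR q b)) ⨟ mk (Z 2 1 0) ⨟ mk (X 1 1 4) =
      (mk (xLeafL (p + 4) a) ⊠ mk (xLeafR (q + 4) b)) ⨟ mk (Z 2 1 0) := by
  have hK : mk (Z 2 1 0) ⨟ mk (X 1 1 4) = (mk (X 1 1 4) ⊠ mk (X 1 1 4)) ⨟ mk (Z 2 1 0) := by
    have h := congrArg transpose K1_red
    simpa using h
  have hL : mk (xLeafL p a) ⨟ mk (X 1 1 4) = mk (xLeafL (p + 4) a) := by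
    simp only [xLeafL, mk_seq, mk_par]
    rw [seq_assoc, show (mk (Z 1 0 a) ⊠ mk (wires 1)) ⨟ mk (X 1 1 4) = (mk (wires 1) ⊠ mk (X 1 1 4)) ⨟ (mk (Z 1 0 a) ⊠ mk (wires 1))
        from by rw [← par_eq_seq_right, par_eq_seq_left (mk (Z 1 0 a)) (mk (X 1 1 4)), empty_par, cast_id],
      ← seq_assoc, X_seq_par_X 1 1 1 1 le_rfl]
  have hR : mk (xLeafR q b) ⨟ mk (X 1 1 4) = mk (xLeafR (q + 4) b) := by
    simp only [xLeafR, mk_seq, mk_par]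
    have hX : mk (X 1 2 q) ⨟ (mk (X 1 1 4) ⊠ mk (wires 1)) = mk (X 1 2 (4 + q)) := by
      have h := congrArg colorSwap (Z_seq_Z_par 1 1 1 1 le_rfl 4 q)
      simpa using h
    rw [seq_assoc, show (mk (wires 1) ⊠ mk (Z 1 0 b)) ⨟ mk (X 1 1 4) = (mk (X 1 1 4) ⊠ mk (wires 1)) ⨟ (mk (wires 1) ⊠ mk (Z 1 0 b))
        from by rw [← par_eq_seq_left, par_eq_seq_right (mk (X 1 1 4)) (mk (Z 1 0 b)), par_empty],
      ← seq_assoc, hX, add_comm (4 : ZMod 8) q]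
  rw [seq_assoc, hK, ← seq_assoc, interchange, hL, hR]

/-- The Hadamard edge between two green copies, drawn as a merge on the left (`Z^{(2,1)}(α)` fed by
the first output of `Z^{(1,2)}(β)` through `H`) or with a Hadamard-capped pair of legs.
[cite: JeandelPerdrixVilmart2018, §2.2] -/
theorem hBox_par_split_hBox_seq_merge (a b : ZMod 8) :
    (mk hBox ⊠ (mk (Z 1 2 b) ⨟ (mk hBox ⊠ mk (wires 1)))) ⨟ (mk (Z 2 1 a) ⊠ mk (wires 1)) =
      (mk hBox ⊠ mk (wires 1)) ⨟ (mk (Z 1 2 a) ⊠ mk (Z 1 2 b)) ⨟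
        ((mk (wires 1) ⊠ ((mk hBox ⊠ mk (wires 1)) ⨟ mk cap)) ⊠ mk (wires 1)) := by
  -- the merge as a bent copy
  have hm : (mk (Z 1 2 a) ⊠ mk (wires 1)) ⨟ (mk (wires 1) ⊠ mk cap) = mk (Z 2 1 a) := by
    rw [show mk (Z 1 2 a) = mk (Z 1 1 a) ⨟ mk (Z 1 2 0) from by rw [Z_seq_Z 1 1 2 le_rfl, add_zero],
      seq_par_wires, seq_assoc, split_par_seq_par_cap, Z_par_seq_Z 1 1 1 1 le_rfl, add_zero a]
  -- the capped layers
  have hl : (mk (wires 2) ⊠ (mk hBox ⊠ mk (wires 1))) ⨟ ((mk (wires 1) ⊠ mk cap) ⊠ mk (wires 1)) =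
      (mk (wires 1) ⊠ ((mk hBox ⊠ mk (wires 1)) ⨟ mk cap)) ⊠ mk (wires 1) := by
    rw [hBox_par_seq_cap_comm, wires_par_seq, seq_par_wires,
      show (mk (wires 1) ⊠ (mk (wires 1) ⊠ mk hBox)) ⊠ mk (wires 1) = mk (wires 2) ⊠ (mk hBox ⊠ mk (wires 1)) from by
        rw [show mk (wires 1) ⊠ (mk (wires 1) ⊠ mk hBox) = mk (wires 2) ⊠ mk hBox from by
              rw [← wires_par_wires 1 1]; exact (par_assoc' _ _ _).trans (cast_id _ _ _)]
        exact (par_assoc _ _ _).trans (cast_id _ _ _)]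
  rw [← hm, seq_par_wires, ← seq_assoc, par_eq_seq_left (mk hBox) (mk (Z 1 2 b) ⨟ (mk hBox ⊠ mk (wires 1))),
    seq_assoc (mk hBox ⊠ mk (wires 1)),
    show (mk (Z 1 2 a) ⊠ mk (wires 1)) ⊠ mk (wires 1) = mk (Z 1 2 a) ⊠ mk (wires 2) from by
      rw [← wires_par_wires 1 1]; exact (par_assoc _ _ _).trans (cast_id _ _ _),
    ← par_eq_seq_right,
    show mk (Z 1 2 a) ⊠ (mk (Z 1 2 b) ⨟ (mk hBox ⊠ mk (wires 1))) = (mk (Z 1 2 a) ⊠ mk (Z 1 2 b)) ⨟ (mk (wires 2) ⊠ (mk hBox ⊠ mk (wires 1)))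
      from by rw [interchange, seq_id],
    seq_assoc, seq_assoc, hl]
  simp only [seq_assoc]

/-- Scalars in front of a map `1 → 3` and a parallel `H`: `(c₋ ⊗ H) ⊗ (A ⨾ ((c₊ ⊗ H) ⊗ 𝕀)) = H ⊗ (A ⨾ (H ⊗ 𝕀))`
when `c₋ ⊗ c₊ = 1` (here the two Euler scalars). [folklore] -/
theorem euler_scalars_extract (A : ZXClass 1 2) :
    ((mk invSqrtTwo ⊠ mk (dumbbell 4 (-1))) ⊠ mk hBox) ⊠ (A ⨟ (((mk invSqrtTwo ⊠ mk (dumbbell 4 1)) ⊠ mk hBox) ⊠ mk (wires 1))) =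
      mk hBox ⊠ (A ⨟ (mk hBox ⊠ mk (wires 1))) := by
  rw [show ((mk invSqrtTwo ⊠ mk (dumbbell 4 1)) ⊠ mk hBox) ⊠ mk (wires 1) = (mk invSqrtTwo ⊠ mk (dumbbell 4 1)) ⊠ (mk hBox ⊠ mk (wires 1))
      from (par_assoc _ _ _).trans (cast_id _ _ _), one_two_seq_scalar_par_two,
    show ∀ (s t : ZXClass 0 0) (B : ZXClass 1 2), ((s ⊠ mk hBox) ⊠ (t ⊠ B)) = s ⊠ (t ⊠ (mk hBox ⊠ B)) from fun s t B => by
      rw [show (s ⊠ mk hBox) ⊠ (t ⊠ B) = s ⊠ (mk hBox ⊠ (t ⊠ B)) from (par_assoc _ _ _).trans (cast_id _ _ _),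
        show mk hBox ⊠ (t ⊠ B) = (mk hBox ⊠ t) ⊠ B from (par_assoc' _ _ _).trans (cast_id _ _ _),
        ← scalar_par_one_comm, show (t ⊠ mk hBox) ⊠ B = t ⊠ (mk hBox ⊠ B) from (par_assoc _ _ _).trans (cast_id _ _ _)],
    show ∀ (s t : ZXClass 0 0) (B : ZXClass 2 3), s ⊠ (t ⊠ B) = (s ⊠ t) ⊠ B from fun s t B => (par_assoc' _ _ _).trans (cast_id _ _ _),
    euler_scalars_cancel, empty_par, cast_id]

/-! ### LMCS Lemma 17 (C1): the gadget equals `√2 ⊗` the fed left-hand side of rule (C) -/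

/-- **(C1), unfolded**: JPV's gadget `G(α,β)` is `√2` times the left-hand side of rule (C) at
`γ = π/2` whose first input carries `Z(-π/2)`, whose second input is fed the red state, whose third
input carries `Z(π/2)`, followed by a red `π`. [cite: JeandelPerdrixVilmart2018, Appendix Lemma 17 (proof)] -/
theorem c1Gadget_eq (a b : ZMod 8) :
    (mk hBox ⊠ mk (wires 1)) ⨟ (mk (Z 1 2 a) ⊠ mk (Z 1 2 b)) ⨟
        ((mk (wires 1) ⊠ ((mk hBox ⊠ mk (wires 1)) ⨟ mk cap)) ⊠ mk (wires 1)) ⨟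
        (mk (xLeafL 4 a) ⊠ mk (xLeafR 0 b)) ⨟ mk (Z 2 1 0) =
      mk (dumbbell 0 0) ⊠ (((mk (Z 1 1 (-2)) ⊠ mk (X 0 1 0)) ⊠ mk (Z 1 1 2)) ⨟ mk (cLhs a b 2) ⨟ mk (X 1 1 4)) := by
  symm
  -- A1: the first layer and (B1)
  have hA1 : mk (dumbbell 0 0) ⊠ (((mk (Z 1 1 (-2)) ⊠ mk (X 0 1 0)) ⊠ mk (Z 1 1 2)) ⨟ ((mk (wires 1) ⊠ mk (Z 1 2 0)) ⊠ mk (wires 1))) =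
      (mk (Z 1 1 (-2)) ⊠ (mk (X 0 1 0) ⊠ mk (X 0 1 0))) ⊠ mk (Z 1 1 2) := by
    rw [interchange, interchange, seq_id, seq_id, ← rule_B1,
      show ∀ (A : ZXClass 1 1) (M : ZXClass 0 2), A ⊠ (mk (dumbbell 0 0) ⊠ M) = (A ⊠ mk (dumbbell 0 0)) ⊠ M
        from fun A M => (par_assoc' _ _ _).trans (cast_id _ _ _), ← scalar_par_one_comm,
      show ∀ (A : ZXClass 1 1) (M : ZXClass 0 2), (mk (dumbbell 0 0) ⊠ A) ⊠ M = mk (dumbbell 0 0) ⊠ (A ⊠ M)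
        from fun A M => (par_assoc _ _ _).trans (cast_id _ _ _),
      show ∀ (N : ZXClass 1 3) (C : ZXClass 1 1), (mk (dumbbell 0 0) ⊠ N) ⊠ C = mk (dumbbell 0 0) ⊠ (N ⊠ C)
        from fun N C => (par_assoc _ _ _).trans (cast_id _ _ _)]
  -- A2: the red `-π/2` absorbs one red state, `Z(π/2)` moves onto a leg of the `β` copy
  have hA2 : ((mk (Z 1 1 (-2)) ⊠ (mk (X 0 1 0) ⊠ mk (X 0 1 0))) ⊠ mk (Z 1 1 2)) ⨟ ((mk (X 2 1 (-2)) ⊠ mk (wires 1)) ⊠ mk (Z 1 2 b)) =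
      ((mk (Z 1 1 (-2)) ⨟ mk (X 1 1 (-2))) ⊠ mk (X 0 1 0)) ⊠ (mk (Z 1 2 b) ⨟ (mk (Z 1 1 2) ⊠ mk (wires 1))) := by
    rw [interchange, show mk (Z 1 1 (-2)) ⊠ (mk (X 0 1 0) ⊠ mk (X 0 1 0)) = (mk (Z 1 1 (-2)) ⊠ mk (X 0 1 0)) ⊠ mk (X 0 1 0)
        from (par_assoc' _ _ _).trans (cast_id _ _ _), interchange, seq_id,
      par_eq_seq_left (mk (Z 1 1 (-2))) (mk (X 0 1 0)), par_empty, seq_assoc, par_X_seq_X 1 0 1 1 le_rfl, add_zero (-2 : ZMod 8),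
      show mk (Z 1 1 2) ⨟ mk (Z 1 2 b) = mk (Z 1 2 b) ⨟ (mk (Z 1 1 2) ⊠ mk (wires 1)) from by
        rw [Z_seq_Z 1 1 2 le_rfl, Z_seq_Z_par 1 1 1 1 le_rfl]]
  -- A3: the red `π/2` absorbs the other red state
  have hA3 : (((mk (Z 1 1 (-2)) ⨟ mk (X 1 1 (-2))) ⊠ mk (X 0 1 0)) ⊠ (mk (Z 1 2 b) ⨟ (mk (Z 1 1 2) ⊠ mk (wires 1)))) ⨟
        ((mk (wires 1) ⊠ mk (X 2 1 2)) ⊠ mk (wires 1)) =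
      (mk (Z 1 1 (-2)) ⨟ mk (X 1 1 (-2))) ⊠ (mk (Z 1 2 b) ⨟ ((mk (Z 1 1 2) ⨟ mk (X 1 1 2)) ⊠ mk (wires 1))) := by
    rw [show ∀ (P : ZXClass 1 1) (R : ZXClass 1 2), (P ⊠ mk (X 0 1 0)) ⊠ R = P ⊠ (mk (X 0 1 0) ⊠ R)
        from fun P R => (par_assoc _ _ _).trans (cast_id _ _ _),
      show (mk (wires 1) ⊠ mk (X 2 1 2)) ⊠ mk (wires 1) = mk (wires 1) ⊠ (mk (X 2 1 2) ⊠ mk (wires 1))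
        from (par_assoc _ _ _).trans (cast_id _ _ _), interchange, seq_id,
      par_eq_seq_right (mk (X 0 1 0)) (mk (Z 1 2 b) ⨟ (mk (Z 1 1 2) ⊠ mk (wires 1))), empty_par, cast_id, seq_assoc, seq_assoc,
      show (mk (X 0 1 0) ⊠ mk (wires 2)) ⨟ (mk (X 2 1 2) ⊠ mk (wires 1)) = mk (X 1 1 2) ⊠ mk (wires 1) from by
        rw [← wires_par_wires 1 1, show mk (X 0 1 0) ⊠ (mk (wires 1) ⊠ mk (wires 1)) = (mk (X 0 1 0) ⊠ mk (wires 1)) ⊠ mk (wires 1)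
          from (par_assoc' _ _ _).trans (cast_id _ _ _), interchange, seq_id, X_par_seq_X 0 1 1 1 le_rfl, zero_add (2 : ZMod 8)],
      ← seq_par_wires]
  -- A4: two Euler forms, scalars cancel
  have hZ21 : mk (Z 2 1 a) = (mk (Z 1 1 (-2)) ⊠ mk (Z 1 1 2)) ⨟ mk (Z 2 1 a) := by
    rw [par_eq_seq_left (mk (Z 1 1 (-2))) (mk (Z 1 1 2)), seq_assoc, par_Z_seq_Z 1 1 1 1 le_rfl, Z_par_seq_Z 1 1 1 1 le_rfl,
      show (-2 : ZMod 8) + (a + 2) = a from by ring]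
  have hA4 : ((mk (Z 1 1 (-2)) ⨟ mk (X 1 1 (-2))) ⊠ (mk (Z 1 2 b) ⨟ ((mk (Z 1 1 2) ⨟ mk (X 1 1 2)) ⊠ mk (wires 1)))) ⨟ (mk (Z 2 1 a) ⊠ mk (wires 1)) =
      (mk hBox ⊠ (mk (Z 1 2 b) ⨟ (mk hBox ⊠ mk (wires 1)))) ⨟ (mk (Z 2 1 a) ⊠ mk (wires 1)) := by
    conv_lhs => rw [hZ21, seq_par_wires (mk (Z 1 1 (-2)) ⊠ mk (Z 1 1 2)) (mk (Z 2 1 a)) 1,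
      show (mk (Z 1 1 (-2)) ⊠ mk (Z 1 1 2)) ⊠ mk (wires 1) = mk (Z 1 1 (-2)) ⊠ (mk (Z 1 1 2) ⊠ mk (wires 1))
        from (par_assoc _ _ _).trans (cast_id _ _ _), ← seq_assoc, interchange, seq_assoc (mk (Z 1 2 b)),
      ← seq_par_wires (mk (Z 1 1 2) ⨟ mk (X 1 1 2)) (mk (Z 1 1 2)) 1, euler_neg, euler_pos,
      show ∀ (s t : ZXClass 0 0), s ⊠ (t ⊠ mk hBox) = (s ⊠ t) ⊠ mk hBox from fun s t => (par_assoc' _ _ _).trans (cast_id _ _ _),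
      show ∀ (s t : ZXClass 0 0), s ⊠ (t ⊠ mk hBox) = (s ⊠ t) ⊠ mk hBox from fun s t => (par_assoc' _ _ _).trans (cast_id _ _ _),
      euler_scalars_extract]
  -- the spine
  simp only [cLhs, xLeafL, xLeafR, mk_seq, mk_par]
  simp only [seq_assoc]
  rw [← seq_assoc _ ((mk (wires 1) ⊠ mk (Z 1 2 0)) ⊠ mk (wires 1)), scalar_par_seq_left, hA1, empty_par, cast_id,
    ← seq_assoc _ ((mk (X 2 1 (-2)) ⊠ mk (wires 1)) ⊠ mk (Z 1 2 b)), hA2,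
    ← seq_assoc _ ((mk (wires 1) ⊠ mk (X 2 1 2)) ⊠ mk (wires 1)), hA3,
    ← seq_assoc _ (mk (Z 2 1 a) ⊠ mk (wires 1)), hA4, hBox_par_split_hBox_seq_merge,
    show (mk (X 1 2 0) ⨟ (mk (Z 1 0 a) ⊠ mk (wires 1))) ⊠ (mk (X 1 2 4) ⨟ (mk (wires 1) ⊠ mk (Z 1 0 b))) ⨟ (mk (Z 2 1 0) ⨟ mk (X 1 1 4)) =
        (mk (xLeafL 4 a) ⊠ mk (xLeafR 0 b)) ⨟ mk (Z 2 1 0) from by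
      rw [← seq_assoc, show mk (X 1 2 0) ⨟ (mk (Z 1 0 a) ⊠ mk (wires 1)) = mk (xLeafL 0 a) from rfl,
        show mk (X 1 2 4) ⨟ (mk (wires 1) ⊠ mk (Z 1 0 b)) = mk (xLeafR 4 b) from rfl, xLeaves_merge_seq_X_pi,
        zero_add, show (4 : ZMod 8) + 4 = 0 from by decide]]
  simp only [xLeafL, xLeafR, mk_seq, mk_par, seq_assoc]

/-- A scalar commutes past a `1 → 2` map. [folklore] -/
theorem scalar_par_one_two_comm (t : ZXClass 0 0) (A : ZXClass 1 2) : t ⊠ A = A ⊠ t := by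
  calc t ⊠ A = (t ⊠ mk (wires 1)) ⨟ (mk (wires 0) ⊠ A) := by rw [par_eq_seq_left]
    _ = (mk (wires 1) ⊠ t) ⨟ (mk (wires 0) ⊠ A) := by rw [scalar_par_wires]
    _ = A ⊠ t := by rw [empty_par, cast_id, par_eq_seq_right A t, par_empty]

/-- The Hadamard edge drawn as a merge on the right. [cite: JeandelPerdrixVilmart2018, §2.2] -/
theorem split_hBox_par_hBox_seq_par_merge (a b : ZMod 8) :
    ((mk (Z 1 2 b) ⨟ (mk (wires 1) ⊠ mk hBox)) ⊠ mk hBox) ⨟ (mk (wires 1) ⊠ mk (Z 2 1 a)) =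
      (mk (wires 1) ⊠ mk hBox) ⨟ (mk (Z 1 2 b) ⊠ mk (Z 1 2 a)) ⨟
        ((mk (wires 1) ⊠ ((mk hBox ⊠ mk (wires 1)) ⨟ mk cap)) ⊠ mk (wires 1)) := by
  -- the merge as a copy bent on the left
  have hbend : (mk (wires 1) ⊠ mk (Z 1 2 0)) ⨟ (mk cap ⊠ mk (wires 1)) = mk (Z 2 1 0) := by
    have h := congrArg colorSwap par_xsplit_seq_cap_par
    simpa using h
  have hm : (mk (wires 1) ⊠ mk (Z 1 2 a)) ⨟ (mk cap ⊠ mk (wires 1)) = mk (Z 2 1 a) := by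
    rw [show mk (Z 1 2 a) = mk (Z 1 1 a) ⨟ mk (Z 1 2 0) from by rw [Z_seq_Z 1 1 2 le_rfl, add_zero],
      wires_par_seq, seq_assoc, hbend, par_Z_seq_Z 1 1 1 1 le_rfl, zero_add a]
  -- the capped layers
  have hl : ((mk (wires 1) ⊠ mk hBox) ⊠ mk (wires 2)) ⨟ (mk (wires 1) ⊠ (mk cap ⊠ mk (wires 1))) =
      (mk (wires 1) ⊠ ((mk hBox ⊠ mk (wires 1)) ⨟ mk cap)) ⊠ mk (wires 1) := by
    rw [← wires_par_wires 1 1,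
      show (mk (wires 1) ⊠ mk hBox) ⊠ (mk (wires 1) ⊠ mk (wires 1)) = (mk (wires 1) ⊠ (mk hBox ⊠ mk (wires 1))) ⊠ mk (wires 1) from by
        rw [show (mk (wires 1) ⊠ mk hBox) ⊠ (mk (wires 1) ⊠ mk (wires 1)) = ((mk (wires 1) ⊠ mk hBox) ⊠ mk (wires 1)) ⊠ mk (wires 1)
          from (par_assoc' _ _ _).trans (cast_id _ _ _),
          show (mk (wires 1) ⊠ mk hBox) ⊠ mk (wires 1) = mk (wires 1) ⊠ (mk hBox ⊠ mk (wires 1)) from (par_assoc _ _ _).trans (cast_id _ _ _)],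
      show mk (wires 1) ⊠ (mk cap ⊠ mk (wires 1)) = (mk (wires 1) ⊠ mk cap) ⊠ mk (wires 1) from (par_assoc' _ _ _).trans (cast_id _ _ _),
      ← seq_par_wires, ← wires_par_seq]
  rw [← hm, wires_par_seq, ← seq_assoc, par_eq_seq_right (mk (Z 1 2 b) ⨟ (mk (wires 1) ⊠ mk hBox)) (mk hBox),
    seq_assoc (mk (wires 1) ⊠ mk hBox),
    show mk (wires 1) ⊠ (mk (wires 1) ⊠ mk (Z 1 2 a)) = mk (wires 2) ⊠ mk (Z 1 2 a) from by
      rw [← wires_par_wires 1 1]; exact (par_assoc' _ _ _).trans (cast_id _ _ _),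
    ← par_eq_seq_left,
    show (mk (Z 1 2 b) ⨟ (mk (wires 1) ⊠ mk hBox)) ⊠ mk (Z 1 2 a) = (mk (Z 1 2 b) ⊠ mk (Z 1 2 a)) ⨟ ((mk (wires 1) ⊠ mk hBox) ⊠ mk (wires 2))
      from by rw [interchange, seq_id],
    seq_assoc, seq_assoc, hl]
  simp only [seq_assoc]

/-- **(C1), mirror image unfolded**: the mirrored gadget is `√2` times the same feeding of the
right-hand side of rule (C). [cite: JeandelPerdrixVilmart2018, Appendix Lemma 17 (proof)] -/
theorem c1GadgetMirror_eq (a b : ZMod 8) :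
    (mk (wires 1) ⊠ mk hBox) ⨟ (mk (Z 1 2 b) ⊠ mk (Z 1 2 a)) ⨟
        ((mk (wires 1) ⊠ ((mk hBox ⊠ mk (wires 1)) ⨟ mk cap)) ⊠ mk (wires 1)) ⨟
        (mk (xLeafL 0 b) ⊠ mk (xLeafR 4 a)) ⨟ mk (Z 2 1 0) =
      mk (dumbbell 0 0) ⊠ (((mk (Z 1 1 (-2)) ⊠ mk (X 0 1 0)) ⊠ mk (Z 1 1 2)) ⨟ mk (cRhs a b 2) ⨟ mk (X 1 1 4)) := by
  symm
  have hA1 : mk (dumbbell 0 0) ⊠ (((mk (Z 1 1 (-2)) ⊠ mk (X 0 1 0)) ⊠ mk (Z 1 1 2)) ⨟ ((mk (wires 1) ⊠ mk (Z 1 2 0)) ⊠ mk (wires 1))) =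
      (mk (Z 1 1 (-2)) ⊠ (mk (X 0 1 0) ⊠ mk (X 0 1 0))) ⊠ mk (Z 1 1 2) := by
    rw [interchange, interchange, seq_id, seq_id, ← rule_B1,
      show ∀ (A : ZXClass 1 1) (M : ZXClass 0 2), A ⊠ (mk (dumbbell 0 0) ⊠ M) = (A ⊠ mk (dumbbell 0 0)) ⊠ M
        from fun A M => (par_assoc' _ _ _).trans (cast_id _ _ _), ← scalar_par_one_comm,
      show ∀ (A : ZXClass 1 1) (M : ZXClass 0 2), (mk (dumbbell 0 0) ⊠ A) ⊠ M = mk (dumbbell 0 0) ⊠ (A ⊠ M)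
        from fun A M => (par_assoc _ _ _).trans (cast_id _ _ _),
      show ∀ (N : ZXClass 1 3) (C : ZXClass 1 1), (mk (dumbbell 0 0) ⊠ N) ⊠ C = mk (dumbbell 0 0) ⊠ (N ⊠ C)
        from fun N C => (par_assoc _ _ _).trans (cast_id _ _ _)]
  -- B2: `Z(-π/2)` enters the `β` copy, the red `π/2` absorbs the second red state
  have hB2 : ((mk (Z 1 1 (-2)) ⊠ (mk (X 0 1 0) ⊠ mk (X 0 1 0))) ⊠ mk (Z 1 1 2)) ⨟ ((mk (Z 1 2 b) ⊠ mk (wires 1)) ⊠ mk (X 2 1 2)) =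
      ((mk (Z 1 1 (-2)) ⨟ mk (Z 1 2 b)) ⊠ mk (X 0 1 0)) ⊠ (mk (Z 1 1 2) ⨟ mk (X 1 1 2)) := by
    rw [show (mk (Z 1 1 (-2)) ⊠ (mk (X 0 1 0) ⊠ mk (X 0 1 0))) ⊠ mk (Z 1 1 2) = (mk (Z 1 1 (-2)) ⊠ mk (X 0 1 0)) ⊠ (mk (X 0 1 0) ⊠ mk (Z 1 1 2)) from by
        rw [show mk (Z 1 1 (-2)) ⊠ (mk (X 0 1 0) ⊠ mk (X 0 1 0)) = (mk (Z 1 1 (-2)) ⊠ mk (X 0 1 0)) ⊠ mk (X 0 1 0)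
          from (par_assoc' _ _ _).trans (cast_id _ _ _)]; exact (par_assoc _ _ _).trans (cast_id _ _ _),
      interchange, interchange, seq_id, par_eq_seq_right (mk (X 0 1 0)) (mk (Z 1 1 2)), empty_par, cast_id, seq_assoc,
      X_par_seq_X 0 1 1 1 le_rfl, zero_add (2 : ZMod 8)]
  -- B3: the red `-π/2` absorbs the first red state
  have hB3 : (((mk (Z 1 1 (-2)) ⨟ mk (Z 1 2 b)) ⊠ mk (X 0 1 0)) ⊠ (mk (Z 1 1 2) ⨟ mk (X 1 1 2))) ⨟ ((mk (wires 1) ⊠ mk (X 2 1 (-2))) ⊠ mk (wires 1)) =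
      ((mk (Z 1 1 (-2)) ⨟ mk (Z 1 2 b)) ⨟ (mk (wires 1) ⊠ mk (X 1 1 (-2)))) ⊠ (mk (Z 1 1 2) ⨟ mk (X 1 1 2)) := by
    rw [interchange, seq_id, par_eq_seq_left (mk (Z 1 1 (-2)) ⨟ mk (Z 1 2 b)) (mk (X 0 1 0)), par_empty, seq_assoc,
      ← wires_par_wires 1 1, show (mk (wires 1) ⊠ mk (wires 1)) ⊠ mk (X 0 1 0) = mk (wires 1) ⊠ (mk (wires 1) ⊠ mk (X 0 1 0))
        from (par_assoc _ _ _).trans (cast_id _ _ _), ← wires_par_seq, par_X_seq_X 1 0 1 1 le_rfl, add_zero (-2 : ZMod 8)]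
  -- B4: two Euler forms, scalars cancel
  have hZ21 : mk (Z 2 1 a) = (mk (Z 1 1 (-2)) ⊠ mk (Z 1 1 2)) ⨟ mk (Z 2 1 a) := by
    rw [par_eq_seq_left (mk (Z 1 1 (-2))) (mk (Z 1 1 2)), seq_assoc, par_Z_seq_Z 1 1 1 1 le_rfl, Z_par_seq_Z 1 1 1 1 le_rfl,
      show (-2 : ZMod 8) + (a + 2) = a from by ring]
  have hB4 : (((mk (Z 1 1 (-2)) ⨟ mk (Z 1 2 b)) ⨟ (mk (wires 1) ⊠ mk (X 1 1 (-2)))) ⊠ (mk (Z 1 1 2) ⨟ mk (X 1 1 2))) ⨟ (mk (wires 1) ⊠ mk (Z 2 1 a)) =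
      ((mk (Z 1 2 b) ⨟ (mk (wires 1) ⊠ mk hBox)) ⊠ mk hBox) ⨟ (mk (wires 1) ⊠ mk (Z 2 1 a)) := by
    conv_lhs => rw [hZ21, wires_par_seq,
      show mk (wires 1) ⊠ (mk (Z 1 1 (-2)) ⊠ mk (Z 1 1 2)) = (mk (wires 1) ⊠ mk (Z 1 1 (-2))) ⊠ mk (Z 1 1 2)
        from (par_assoc' _ _ _).trans (cast_id _ _ _), ← seq_assoc, interchange,
      seq_assoc (mk (Z 1 1 (-2)) ⨟ mk (Z 1 2 b)), ← wires_par_seq,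
      show mk (Z 1 1 (-2)) ⨟ mk (Z 1 2 b) = mk (Z 1 2 b) ⨟ (mk (wires 1) ⊠ mk (Z 1 1 (-2))) from by
        rw [Z_seq_Z 1 1 2 le_rfl, Z_seq_par_Z 1 1 1 1 le_rfl, add_comm],
      seq_assoc (mk (Z 1 2 b)), ← wires_par_seq, ← seq_assoc (mk (Z 1 1 (-2))) (mk (X 1 1 (-2))), euler_neg, euler_pos,
      ← scalar_par_wires_par_one, ← scalar_par_wires_par_one, one_two_seq_scalar_par_two, one_two_seq_scalar_par_two,
      show ∀ (s t : ZXClass 0 0) (T : ZXClass 1 2), s ⊠ (t ⊠ T) = (s ⊠ t) ⊠ T from fun s t T => (par_assoc' _ _ _).trans (cast_id _ _ _),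
      show ∀ (s t : ZXClass 0 0) (V : ZXClass 1 1), s ⊠ (t ⊠ V) = (s ⊠ t) ⊠ V from fun s t V => (par_assoc' _ _ _).trans (cast_id _ _ _),
      show ∀ (s t : ZXClass 0 0) (T : ZXClass 1 2), (s ⊠ T) ⊠ (t ⊠ mk hBox) = s ⊠ (t ⊠ (T ⊠ mk hBox)) from fun s t T => by
        rw [show (s ⊠ T) ⊠ (t ⊠ mk hBox) = s ⊠ (T ⊠ (t ⊠ mk hBox)) from (par_assoc _ _ _).trans (cast_id _ _ _),
          show T ⊠ (t ⊠ mk hBox) = (T ⊠ t) ⊠ mk hBox from (par_assoc' _ _ _).trans (cast_id _ _ _),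
          ← scalar_par_one_two_comm, show (t ⊠ T) ⊠ mk hBox = t ⊠ (T ⊠ mk hBox) from (par_assoc _ _ _).trans (cast_id _ _ _)],
      show ∀ (s t : ZXClass 0 0) (B : ZXClass 2 3), s ⊠ (t ⊠ B) = (s ⊠ t) ⊠ B from fun s t B => (par_assoc' _ _ _).trans (cast_id _ _ _),
      euler_scalars_cancel, empty_par, cast_id]
  -- the spine
  simp only [cRhs, xLeafL, xLeafR, mk_seq, mk_par]
  simp only [seq_assoc]
  rw [← seq_assoc _ ((mk (wires 1) ⊠ mk (Z 1 2 0)) ⊠ mk (wires 1)), scalar_par_seq_left, hA1, empty_par, cast_id,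
    ← seq_assoc _ ((mk (Z 1 2 b) ⊠ mk (wires 1)) ⊠ mk (X 2 1 2)), hB2,
    ← seq_assoc _ ((mk (wires 1) ⊠ mk (X 2 1 (-2))) ⊠ mk (wires 1)), hB3,
    ← seq_assoc _ (mk (wires 1) ⊠ mk (Z 2 1 a)), hB4, split_hBox_par_hBox_seq_par_merge,
    show (mk (X 1 2 4) ⨟ (mk (Z 1 0 b) ⊠ mk (wires 1))) ⊠ (mk (X 1 2 0) ⨟ (mk (wires 1) ⊠ mk (Z 1 0 a))) ⨟ (mk (Z 2 1 0) ⨟ mk (X 1 1 4)) =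
        (mk (xLeafL 0 b) ⊠ mk (xLeafR 4 a)) ⨟ mk (Z 2 1 0) from by
      rw [← seq_assoc, show mk (X 1 2 4) ⨟ (mk (Z 1 0 b) ⊠ mk (wires 1)) = mk (xLeafL 4 b) from rfl,
        show mk (X 1 2 0) ⨟ (mk (wires 1) ⊠ mk (Z 1 0 a)) = mk (xLeafR 0 a) from rfl, xLeaves_merge_seq_X_pi,
        zero_add, show (4 : ZMod 8) + 4 = 0 from by decide]]
  simp only [xLeafL, xLeafR, mk_seq, mk_par, seq_assoc]

/-- **LMCS Lemma 17 = JPV's Lemma (C1)**: the gadget `G(α,β)` equals its mirror image.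
`G(α,β)`: a Hadamard on the first input; green copies `Z^{(1,2)}(α)`, `Z^{(1,2)}(β)` on the two
wires joined by a Hadamard edge; a red `π` with a green `α` leaf on the first wire and a red node
with a green `β` leaf on the second; a final green merge. [cite: JeandelPerdrixVilmart2018, Appendix Lemma 17] -/
theorem c1Gadget_eq_mirror (a b : ZMod 8) :
    (mk hBox ⊠ mk (wires 1)) ⨟ (mk (Z 1 2 a) ⊠ mk (Z 1 2 b)) ⨟
        ((mk (wires 1) ⊠ ((mk hBox ⊠ mk (wires 1)) ⨟ mk cap)) ⊠ mk (wires 1)) ⨟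
        (mk (xLeafL 4 a) ⊠ mk (xLeafR 0 b)) ⨟ mk (Z 2 1 0) =
      (mk (wires 1) ⊠ mk hBox) ⨟ (mk (Z 1 2 b) ⊠ mk (Z 1 2 a)) ⨟
        ((mk (wires 1) ⊠ ((mk hBox ⊠ mk (wires 1)) ⨟ mk cap)) ⊠ mk (wires 1)) ⨟
        (mk (xLeafL 0 b) ⊠ mk (xLeafR 4 a)) ⨟ mk (Z 2 1 0) := by
  rw [c1Gadget_eq, c1GadgetMirror_eq, rule_C]

end ZXClass

end Literature.Computability.QuantumComplexity
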